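import Summits.Schanuel.Schanuel.Theorems.ZilberEacCancellingFibreExistence
import HarnessLib

/-!
# The double-cancelling regime: the rescaling identity

Zilber's Exponential-Algebraic Closedness, case ladder (host summit Schanuel, cell `pub-schanuel`,
seat 2, gen 15).  Notation of `ZilberEacDoubleCancellingSystem` (HANDOFF O59 PLAN): `a₀ = A_{0,e₀−1}`,
`τ = Log(2πin/(r₀a₀s))`, `μ = 1/(2πisn)`, `σ = e^{−τ/e₀}`, `S = e^{τ/e₀}`, `ω = e^{2πi/e₀}`,
`P = Sω^{j₀}`, `Wⱼ(w) = Σ_{i<eⱼ}A_{j,i}P^{i+1}e^{(i+1)w/e₀}`.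

* **`doubleCancelling_key`** — `(2πisn)·clean((ν, μ, σ, θ), w) = (−2πisn + (τ + 2πij₀)/e₀) + w/e₀ +
  r₀W₀(w) + r₁W₁(w) − c`: the clean rescaled system of `exists_clean_doubleCancelling` IS the plane
  equation with `xⱼ = −Wⱼ` divided by `2πisn` (uses `r₀a₀S^{e₀} = 2πisn`, `Sσ = 1`, `ω^{e₀} = 1`).

HONEST FRAMING: an algebraic identity serving explicit members of an OPEN cell (`ECCell 3 2`);
NOT Schanuel's conjecture; EAC ⇏ SC.
-/

noncomputable section

open Complex Filter Topology

set_option linter.dupNamespace false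

namespace Summit.Schanuel.Schanuel.Theorems

section Key

/-- **The rescaling identity of the double-cancelling regime.**  See the module docstring. (new) -/
theorem doubleCancelling_key (e₀ e₁ : ℕ) (he₀ : 1 ≤ e₀) (A : Fin 2 → ℕ → ℂ)
    (ha₀ : A 0 (e₀ - 1) ≠ 0) (r₀ r₁ : ℝ) (hr₀ : r₀ ≠ 0) (c : ℂ) {s : ℝ} (hs : s = 1 ∨ s = -1)
    (j₀ : ℕ) {n : ℕ} (hn : 1 ≤ n) (w : ℂ) :
    let a₀ : ℂ := A 0 (e₀ - 1)
    let τ : ℂ := Complex.log (2 * Real.pi * I * (n : ℂ) / ((r₀ : ℂ) * (a₀ * s)))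
    let μ : ℂ := (2 * Real.pi * I * (s : ℂ) * (n : ℂ))⁻¹
    let σ : ℂ := exp (-τ / (e₀ : ℂ))
    let P : ℂ := exp (τ / (e₀ : ℂ)) * exp (2 * Real.pi * I / (e₀ : ℂ)) ^ j₀
    (2 * Real.pi * I * (s : ℂ) * (n : ℂ)) *
        (-1 + exp w + μ * ((τ + 2 * Real.pi * I * j₀) / (e₀ : ℂ) - c) + μ * w / (e₀ : ℂ) +
          σ * (∑ i ∈ Finset.range (e₀ - 1), A 0 i / a₀ * σ ^ (e₀ - 2 - i) *
            exp (2 * Real.pi * I / (e₀ : ℂ)) ^ (j₀ * (i + 1)) * exp ((((i : ℕ) : ℂ) + 1) * w / (e₀ : ℂ))) +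
          μ * (r₁ : ℂ) * exp ((e₁ : ℂ) * τ / (e₀ : ℂ)) *
            (∑ i ∈ Finset.range e₁, A 1 i * σ ^ (e₁ - 1 - i) *
              exp (2 * Real.pi * I / (e₀ : ℂ)) ^ (j₀ * (i + 1)) * exp ((((i : ℕ) : ℂ) + 1) * w / (e₀ : ℂ)))) =
      (-(2 * Real.pi * I * (s : ℂ) * (n : ℂ)) + (τ + 2 * Real.pi * I * j₀) / (e₀ : ℂ)) + w / (e₀ : ℂ) +
        (r₀ : ℂ) * (∑ i ∈ Finset.range e₀, A 0 i * P ^ (i + 1) * exp ((((i : ℕ) : ℂ) + 1) * w / (e₀ : ℂ))) +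
        (r₁ : ℂ) * (∑ i ∈ Finset.range e₁, A 1 i * P ^ (i + 1) * exp ((((i : ℕ) : ℂ) + 1) * w / (e₀ : ℂ))) -
        c := by
  intro a₀ τ μ σ P
  have ha₀' : a₀ ≠ 0 := ha₀
  have heC : (e₀ : ℂ) ≠ 0 := by exact_mod_cast (show e₀ ≠ 0 by omega)
  have hr₀C : (r₀ : ℂ) ≠ 0 := by exact_mod_cast hr₀
  have h2πI : (2 * Real.pi * I : ℂ) ≠ 0 := Complex.two_pi_I_ne_zero
  have hsC : (s : ℂ) ≠ 0 := by rcases hs with h | h <;> simp [h]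
  have hAs : a₀ * (s : ℂ) ≠ 0 := mul_ne_zero ha₀' hsC
  have hnC : (n : ℂ) ≠ 0 := by exact_mod_cast (show n ≠ 0 by omega)
  set S : ℂ := exp (τ / (e₀ : ℂ)) with hSdef
  set ω : ℂ := exp (2 * Real.pi * I / (e₀ : ℂ)) with hω
  have hωe : ω ^ e₀ = 1 := by
    rw [hω, ← Complex.exp_nat_mul, mul_div_cancel₀ _ heC]
    exact Complex.exp_two_pi_mul_I
  have hτexp : exp τ = 2 * Real.pi * I * (n : ℂ) / ((r₀ : ℂ) * (a₀ * s)) :=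
    Complex.exp_log (div_ne_zero (mul_ne_zero h2πI hnC) (mul_ne_zero hr₀C hAs))
  have hS : (r₀ : ℂ) * a₀ * S ^ e₀ = 2 * Real.pi * I * (s : ℂ) * (n : ℂ) := by
    rw [hSdef, ← Complex.exp_nat_mul, mul_div_cancel₀ _ heC, hτexp]
    rcases hs with h | h
    · rw [h]; field_simp; push_cast; ring
    · rw [h]; field_simp; push_cast; ring
  have hK : (2 * Real.pi * I * (s : ℂ) * (n : ℂ)) * μ = 1 :=
    mul_inv_cancel₀ (mul_ne_zero (mul_ne_zero h2πI hsC) hnC)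
  have hSσ : S * σ = 1 := by
    show exp (τ / (e₀ : ℂ)) * exp (-τ / (e₀ : ℂ)) = 1
    rw [← Complex.exp_add, show τ / (e₀ : ℂ) + -τ / (e₀ : ℂ) = 0 by ring, Complex.exp_zero]
  have hSe₁ : exp ((e₁ : ℂ) * τ / (e₀ : ℂ)) = S ^ e₁ := by
    rw [hSdef, ← Complex.exp_nat_mul, mul_div_assoc]
  have hPpow : ∀ i : ℕ, P ^ (i + 1) = S ^ (i + 1) * ω ^ (j₀ * (i + 1)) := by
    intro i
    show (exp (τ / (e₀ : ℂ)) * exp (2 * Real.pi * I / (e₀ : ℂ)) ^ j₀) ^ (i + 1) = _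
    rw [mul_pow, ← pow_mul]
  rw [hSe₁]
  -- opaque atoms for the inner sums
  obtain ⟨R₁, hR₁⟩ : ∃ R : ℂ, (∑ i ∈ Finset.range e₁, A 1 i * σ ^ (e₁ - 1 - i) *
    ω ^ (j₀ * (i + 1)) * exp ((((i : ℕ) : ℂ) + 1) * w / (e₀ : ℂ))) = R := ⟨_, rfl⟩
  obtain ⟨R₀, hR₀⟩ : ∃ R : ℂ, (∑ i ∈ Finset.range (e₀ - 1), A 0 i / a₀ * σ ^ (e₀ - 2 - i) *
    ω ^ (j₀ * (i + 1)) * exp ((((i : ℕ) : ℂ) + 1) * w / (e₀ : ℂ))) = R := ⟨_, rfl⟩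
  have hW1 : (∑ i ∈ Finset.range e₁, A 1 i * P ^ (i + 1) * exp ((((i : ℕ) : ℂ) + 1) * w / (e₀ : ℂ))) =
      S ^ e₁ * R₁ := by
    rw [← hR₁, Finset.mul_sum]
    refine Finset.sum_congr rfl fun i hi => ?_
    have hi' : i < e₁ := Finset.mem_range.1 hi
    rw [hPpow i, pow_succ_eq_pow_mul_inv_pow hSσ hi']
    ring
  have hW0 : (r₀ : ℂ) * (∑ i ∈ Finset.range e₀, A 0 i * P ^ (i + 1) *
      exp ((((i : ℕ) : ℂ) + 1) * w / (e₀ : ℂ))) = (2 * Real.pi * I * (s : ℂ) * (n : ℂ)) * (exp w + σ * R₀) := by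
    rw [show Finset.range e₀ = Finset.range (e₀ - 1 + 1) by rw [Nat.sub_add_cancel he₀],
      Finset.sum_range_succ, Nat.sub_add_cancel he₀, mul_add]
    have htop : (r₀ : ℂ) * (A 0 (e₀ - 1) * P ^ e₀ * exp ((((e₀ - 1 : ℕ) : ℂ) + 1) * w / (e₀ : ℂ))) =
        (2 * Real.pi * I * (s : ℂ) * (n : ℂ)) * exp w := by
      rw [← hS, show P ^ e₀ = S ^ e₀ * ω ^ (j₀ * e₀) by
          show (exp (τ / (e₀ : ℂ)) * exp (2 * Real.pi * I / (e₀ : ℂ)) ^ j₀) ^ e₀ = _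
          rw [mul_pow, ← pow_mul],
        mul_comm j₀ e₀, pow_mul, hωe, one_pow, mul_one,
        show (((e₀ - 1 : ℕ) : ℂ) + 1) = (e₀ : ℂ) by rw [Nat.cast_sub he₀]; push_cast; ring,
        mul_div_cancel_left₀ _ heC]
      show (r₀ : ℂ) * (a₀ * S ^ e₀ * exp w) = (r₀ : ℂ) * a₀ * S ^ e₀ * exp w
      ring
    have hrest : (r₀ : ℂ) * ∑ i ∈ Finset.range (e₀ - 1), A 0 i * P ^ (i + 1) *
        exp ((((i : ℕ) : ℂ) + 1) * w / (e₀ : ℂ)) = (2 * Real.pi * I * (s : ℂ) * (n : ℂ)) * (σ * R₀) := by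
      rw [← hR₀, ← hS, Finset.mul_sum, Finset.mul_sum, Finset.mul_sum]
      refine Finset.sum_congr rfl fun i hi => ?_
      have hi' : i < e₀ - 1 := Finset.mem_range.1 hi
      rw [hPpow i, pow_succ_eq_pow_mul_inv_pow hSσ (show i < e₀ by omega),
        show e₀ - 1 - i = (e₀ - 2 - i) + 1 by omega, pow_succ]
      field_simp
    rw [hrest, htop]
    ring
  rw [hR₀, hR₁, hW0, hW1]
  linear_combination ((τ + 2 * Real.pi * I * j₀) / (e₀ : ℂ) - c + w / (e₀ : ℂ) +
    (r₁ : ℂ) * S ^ e₁ * R₁) * hK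

end Key

end Summit.Schanuel.Schanuel.Theorems

end
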